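import Literature.Topology.FourManifolds.KirbyMovesBlowDown
import Literature.Topology.FourManifolds.LinkTubularUniqueness
import Literature.Topology.FourManifolds.DehnSurgeryTwistProofs
import HarnessLib

/-!
# Shrinking the tubes of a surgery presentation: leaf (A) of the blow-down move discharged

Sibling proof file of `KirbyMovesBlowDown.lean` (D-0014: named facts `def X : Prop` are
discharged as `theorem X_holds : X`). That file reduced leaf **(B)** of Kirby's theorem
(`Literature.Topology.FourManifolds.FramedLink.IsBlowDown.isSurgery`: blowing down a split
`±1`-framed unknot does not change the surgered 3-manifold; R. C. Kirby, *The Topology of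
4-Manifolds*, LNM 1374 (1989), Ch. I §5, Thm. 5.1, move (2)) to three named facts (A) `shrink`,
(B) `framedUniqueness`, (C) `blowDownModel` (`FramedLink.IsBlowDown.isSurgery_of`). This file
**proves leaf (A)**:

* `Literature.Topology.FourManifolds.Link.IsSurgeryPresentation.shrink_holds :
  Link.IsSurgeryPresentation.shrink` — if `Y` (any model) is presented as surgery on the link `L`
  with pairwise disjoint oriented tubular neighbourhoods `νᵢ` of framings `mᵢ`, then for any open
  neighbourhoods `Vᵢ ⊇ Kᵢ(S¹)` of the components it is also presented with tubular neighbourhoods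
  of the same framings and the same images whose closed unit tubes lie in the `Vᵢ`.

The surgery only depends on the germ of the tubular neighbourhoods along the link (Rolfsen,
*Knots and Links* (1976), §9.F: the construction may use a tubular neighbourhood of any radius;
Kosinski, *Differential Manifolds* (1993), Ch. III (3.4): shrinking tubular neighbourhoods).

## Proof

* `Literature.Topology.FourManifolds.Knot.TubularNbhd.scale ν r` (`0 < r`): the rescaled tubular
  neighbourhood `(x, w) ↦ ν (x, r • w)` — a smooth embedding (precomposition with the fibre
  dilation `fibreDilation r`, a diffeomorphism of `S¹ × ℝ²`), equal to `K` on the zero section,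
  positively oriented (the two fibre rows of the Jacobian frame of `det_pos` are multiplied by
  `r`, `frameDet_smul₂`), with the same image (`range_scale`) and closed unit tube the closed tube
  of radius `r` of `ν` (`image_scale_closedBall`), which lies in a prescribed neighbourhood of the
  knot for small `r` (`exists_image_closedBall_subset`, tube lemma).
* `Literature.Topology.FourManifolds.Knot.TubularNbhd.HasFraming.scale`: **rescaling preserves
  the framing integer.** The radial reparametrisation `sphereRescale ν r` of `S³` — `ν (x, w) ↦
  ν (x, λ_r(‖w‖) w)` on the tube, with `λ_r = r` on `[0, 1]` and `= 1` on `[2, ∞)`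
  (`rescaleProfile`, `planeRescale`), the identity off the tube — is continuous (the two
  descriptions agree off the compact tube of radius `2`), maps the knot complement to itself
  (`complRescale`, a `C(S³ ∖ K, S³ ∖ K)`) and carries the meridian and longitude of `ν` onto
  those of `ν.scale r` (`meridian_scale`, `longitude_scale`); the induced homomorphism of
  abelianised fundamental groups (`FundamentalGroup.mapOfEq`, `Abelianization.map`) transports
  `[λ] = m • [μ]` — the pattern of the tree's `HasFraming.isoTransport`
  (`KirbyMovesIsotopyProofs.lean`).
* `Literature.Topology.FourManifolds.solidTorusScale r` (`0 < r ≤ 1`): the open embedding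
  `(p, v) ↦ (r p, v)` of the open solid torus onto `{‖p‖ < r}` as an `OpenPartialHomeomorph`
  with source `univ`, smooth with smooth inverse, so that `jBᵢ ∘ solidTorusScale rᵢ` is again a
  smooth open embedding (the tree's `Manifold.IsSmoothEmbedding.comp_openPartialHomeomorph`,
  `SmoothEmbeddingComp.lean`).
* `Literature.Topology.FourManifolds.Link.IsSurgeryPresentation.scale`: keep the embedding `jA`
  of the link complement, replace `jBᵢ` by `jBᵢ ∘ solidTorusScale rᵢ`; the annulus
  `jBᵢ {rᵢ ≤ ‖p‖ < 1}` is covered by `jA` (the point `νᵢ (u, t v)` glued to `jBᵢ (t u, v)` lies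
  off every component by the disjointness of the tubes), and the surgery relations correspond
  (`Knot.TubularNbhd.glueRel_scale_iff`: radius `t` for `νᵢ.scale rᵢ` is radius `rᵢ t` for
  `νᵢ`).

## References

* D. Rolfsen, *Knots and Links*, Publish or Perish (1976), §9.F. [cite: Rolfsen1976, §9.F]
* A. Kosinski, *Differential Manifolds*, Academic Press (1993), Ch. III, (3.4)–(3.5).
  [cite: Kosinski1993, Ch. III Thm (3.5)]
* R. C. Kirby, *The Topology of 4-Manifolds*, LNM 1374, Springer (1989), Ch. I §5, Thm. 5.1.
  [cite: Kirby1989, Ch. I §5 Thm 5.1]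

## Design notes

* `LinkTubularUniqueness.lean` is imported for the partial homeomorphism `Knot.TubularNbhd.toHomeo`
  (the inverse of `ν` on its open image), `DehnSurgeryTwistProofs.lean` for the coordinate
  expression `Knot.TubularNbhd.coordMap` and its Jacobian frame (`tubeFrameDet_coordMap_pos`,
  `deriv_coordMap_line`).
* The finite-dimensionality `Fact`s of `DehnSurgeryTubularNbhdProofs.lean` are used as local
  instances, as there; no global instance is registered.
* No declaration in this file uses `sorry`; `Link.IsSurgeryPresentation.shrink_holds` depends
  only on the axioms `propext`, `Classical.choice`, `Quot.sound`.
-/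

open scoped Manifold ContDiff Topology
open Function Set

noncomputable section

namespace Literature.Topology.FourManifolds

/-- Local notation: `𝔼 n` is the model Euclidean space `EuclideanSpace ℝ (Fin n)`. -/
local notation "𝔼 " n:arg => EuclideanSpace ℝ (Fin n)

/-- Local notation: `𝕊 n` is the unit sphere in `EuclideanSpace ℝ (Fin (n + 1))`. -/
local notation "𝕊 " n:arg => (Metric.sphere (0 : EuclideanSpace ℝ (Fin (n + 1))) 1)

section FibreScale

/-- The dilation `w ↦ r • w` of the plane (`r ≠ 0`) as a continuous linear automorphism. [folklore] -/
def planeDilation (r : ℝ) (hr : r ≠ 0) : (𝔼 2) ≃L[ℝ] 𝔼 2 :=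
  ContinuousLinearEquiv.smulLeft (Units.mk0 r hr)

/-- The plane dilation on points. [folklore] -/
@[simp] theorem planeDilation_apply (r : ℝ) (hr : r ≠ 0) (w : 𝔼 2) :
    planeDilation r hr w = r • w := rfl

/-- The fibre dilation `(x, w) ↦ (x, r • w)` of `S¹ × ℝ²` (`r ≠ 0`), a diffeomorphism. [folklore] -/
def fibreDilation (r : ℝ) (hr : r ≠ 0) :
    ((𝕊 1) × 𝔼 2) ≃ₘ⟮(𝓡 1).prod 𝓘(ℝ, 𝔼 2), (𝓡 1).prod 𝓘(ℝ, 𝔼 2)⟯ ((𝕊 1) × 𝔼 2) :=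
  Diffeomorph.prodCongr (Diffeomorph.refl (𝓡 1) (𝕊 1) ∞) (planeDilation r hr).toDiffeomorph

/-- The fibre dilation on points. [folklore] -/
@[simp] theorem fibreDilation_apply (r : ℝ) (hr : r ≠ 0) (p : (𝕊 1) × 𝔼 2) :
    fibreDilation r hr p = (p.1, r • p.2) := rfl

/-- Homogeneity of `frameDet` in the last two rows. [folklore] -/
theorem frameDet_smul₂ (r₀ r₁ r₂ r₃ : 𝔼 4) (a : ℝ) :
    frameDet r₀ r₁ (a • r₂) (a • r₃) = a * a * frameDet r₀ r₁ r₂ r₃ := by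
  have h := frameDet_comb₂ r₀ r₁ r₂ r₃ a 0 0 a
  simp only [zero_smul, add_zero, zero_add, mul_zero, sub_zero] at h
  exact h

end FibreScale

namespace Knot.TubularNbhd

attribute [local instance] fact_finrank_euclideanSpace_two fact_finrank_euclideanSpace_four

variable {K : 𝕊 1 → 𝕊 3} (ν : Knot.TubularNbhd K) (r : ℝ) (hr : 0 < r)

/-- **The rescaled tubular neighbourhood** `ν.scale r = ν ∘ (id × r •)`, `(x, w) ↦ ν (x, r • w)`
(`0 < r`): again an oriented tubular neighbourhood of the same knot with the same image — a smooth
embedding (precomposition with the fibre dilation), equal to `K` on the zero section, and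
positively oriented (its Jacobian frame at `(θ, w)` is that of `ν` at `(θ, r • w)` with the two
fibre rows multiplied by `r`, determinant factor `r² > 0`). Its unit tube is the tube of radius
`r` of `ν`. Kosinski, *Differential Manifolds* (1993), III.(3.4); Rolfsen (1976), §9.F.
[folklore] -/
def scale : Knot.TubularNbhd K where
  toFun p := ν (p.1, r • p.2)
  isSmoothEmbedding := by
    have : (fun p : (𝕊 1) × 𝔼 2 ↦ ν (p.1, r • p.2)) = ⇑ν ∘ fibreDilation r hr.ne' := by
      funext p; rfl
    rw [this]
    exact isSmoothEmbedding_comp_diffeomorph ν.isSmoothEmbedding_coe (fibreDilation r hr.ne')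
  apply_zero x := by
    change ν (x, r • (0 : 𝔼 2)) = K x
    rw [smul_zero, ν.coe_apply_zero]
  det_pos θ w := by
    set G := ν.coordMap with hGdef
    set L : ℝ × 𝔼 2 →L[ℝ] 𝔼 4 := fderiv ℝ G (θ, r • w) with hL
    set e₀ : 𝔼 2 := EuclideanSpace.single 0 (1 : ℝ) with he₀
    set e₁ : 𝔼 2 := EuclideanSpace.single 1 (1 : ℝ) with he₁
    have h1 : deriv (fun t : ℝ ↦ G (t, r • w)) θ = L (1, 0) := by
      rw [hL, deriv_fst_eq_fderiv (ν.differentiable_coordMap _)]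
    have hline : ∀ i : Fin 2,
        (fun s : ℝ ↦ G (θ, r • (w + EuclideanSpace.single i s))) =
        fun s ↦ G (θ, r • w + s • (r • EuclideanSpace.single i (1 : ℝ))) := by
      intro i
      funext s
      rw [smul_add, euclideanSpace_single_eq_smul i s, smul_comm r s]
    have h2 : deriv (fun s : ℝ ↦ G (θ, r • (w + EuclideanSpace.single 0 s))) 0 = r • L (0, e₀) := by
      rw [hline 0, hGdef, deriv_coordMap_line, ← hGdef, ← hL, ← map_smul]
      simp [he₀]
    have h3 : deriv (fun s : ℝ ↦ G (θ, r • (w + EuclideanSpace.single 1 s))) 0 = r • L (0, e₁) := by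
      rw [hline 1, hGdef, deriv_coordMap_line, ← hGdef, ← hL, ← map_smul]
      simp [he₁]
    change 0 < frameDet (G (θ, r • w)) (deriv (fun t : ℝ ↦ G (t, r • w)) θ)
      (deriv (fun s : ℝ ↦ G (θ, r • (w + EuclideanSpace.single 0 s))) 0)
      (deriv (fun s : ℝ ↦ G (θ, r • (w + EuclideanSpace.single 1 s))) 0)
    rw [h1, h2, h3, frameDet_smul₂]
    exact mul_pos (mul_pos hr hr) (ν.tubeFrameDet_coordMap_pos θ (r • w))

/-- The rescaled tubular neighbourhood on points. [folklore] -/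
@[simp] theorem scale_apply (p : (𝕊 1) × 𝔼 2) : ν.scale r hr p = ν (p.1, r • p.2) := rfl

/-- **Rescaling does not change the image** of the tubular neighbourhood. [folklore] -/
theorem range_scale : range ⇑(ν.scale r hr) = range ⇑ν := by
  have : ⇑(ν.scale r hr) = ⇑ν ∘ fibreDilation r hr.ne' := by funext p; rfl
  rw [this, (EquivLike.surjective (fibreDilation r hr.ne')).range_comp]

/-- The closed unit tube of `ν.scale r` is the closed tube of radius `r` of `ν`. [folklore] -/
theorem image_scale_closedBall :
    ν.scale r hr '' (univ ×ˢ Metric.closedBall (0 : 𝔼 2) 1) =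
      ν '' (univ ×ˢ Metric.closedBall (0 : 𝔼 2) r) := by
  ext p
  simp only [mem_image, mem_prod, mem_univ, true_and, Metric.mem_closedBall, dist_zero_right,
    scale_apply, Prod.exists]
  constructor
  · rintro ⟨x, w, hw, rfl⟩
    refine ⟨x, r • w, ?_, rfl⟩
    rw [norm_smul, Real.norm_of_nonneg hr.le]
    nlinarith
  · rintro ⟨x, w, hw, rfl⟩
    refine ⟨x, r⁻¹ • w, ?_, by rw [smul_inv_smul₀ hr.ne']⟩
    rw [norm_smul, norm_inv, Real.norm_of_nonneg hr.le]
    rw [inv_mul_le_iff₀ hr]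
    simpa using hw

end Knot.TubularNbhd

/-! ### A radial reparametrisation of the plane -/

section Radial

/-- The radial profile `λ_r (s) = r` for `s ≤ 1`, `= 1` for `s ≥ 2`, affine in between. [folklore] -/
def rescaleProfile (r s : ℝ) : ℝ := r + (1 - r) * max 0 (min 1 (s - 1))

/-- The radial profile is continuous in `s`. [folklore] -/
theorem continuous_rescaleProfile (r : ℝ) : Continuous (rescaleProfile r) := by
  unfold rescaleProfile; fun_prop

/-- The radial profile is `r` on `s ≤ 1`. [folklore] -/
theorem rescaleProfile_of_le_one (r : ℝ) {s : ℝ} (hs : s ≤ 1) : rescaleProfile r s = r := by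
  unfold rescaleProfile
  rw [max_eq_left (min_le_of_right_le (by linarith)), mul_zero, add_zero]

/-- The radial profile is `1` on `2 ≤ s`. [folklore] -/
theorem rescaleProfile_of_two_le (r : ℝ) {s : ℝ} (hs : 2 ≤ s) : rescaleProfile r s = 1 := by
  unfold rescaleProfile
  rw [min_eq_left (by linarith : (1 : ℝ) ≤ s - 1), max_eq_right zero_le_one]
  ring

/-- The radial profile of a positive `r` is positive. [folklore] -/
theorem rescaleProfile_pos {r : ℝ} (hr : 0 < r) (s : ℝ) : 0 < rescaleProfile r s := by
  unfold rescaleProfile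
  set c := max 0 (min 1 (s - 1)) with hc
  have hc0 : 0 ≤ c := le_max_left _ _
  have hc1 : c ≤ 1 := max_le zero_le_one (min_le_left _ _)
  rcases eq_or_lt_of_le hc1 with h1 | h1
  · rw [h1]; linarith
  · nlinarith [mul_pos hr (sub_pos.2 h1)]

/-- The **radial reparametrisation** `ρ_r (w) = λ_r (‖w‖) • w` of the plane: multiplication by
`r` on the closed unit disc, the identity off the disc of radius `2`, never `0` off the origin
(for `0 < r`). [folklore] -/
def planeRescale (r : ℝ) (w : 𝔼 2) : 𝔼 2 := rescaleProfile r ‖w‖ • w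

/-- The radial reparametrisation is continuous. [folklore] -/
theorem continuous_planeRescale (r : ℝ) : Continuous (planeRescale r) :=
  ((continuous_rescaleProfile r).comp continuous_norm).smul continuous_id

/-- On the closed unit disc the radial reparametrisation is multiplication by `r`. [folklore] -/
theorem planeRescale_of_norm_le_one (r : ℝ) {w : 𝔼 2} (hw : ‖w‖ ≤ 1) : planeRescale r w = r • w := by
  rw [planeRescale, rescaleProfile_of_le_one r hw]

/-- Off the disc of radius `2` the radial reparametrisation is the identity. [folklore] -/
theorem planeRescale_of_two_le_norm (r : ℝ) {w : 𝔼 2} (hw : 2 ≤ ‖w‖) : planeRescale r w = w := by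
  rw [planeRescale, rescaleProfile_of_two_le r hw, one_smul]

/-- The radial reparametrisation of a positive `r` vanishes only at the origin. [folklore] -/
theorem planeRescale_ne_zero {r : ℝ} (hr : 0 < r) {w : 𝔼 2} (hw : w ≠ 0) : planeRescale r w ≠ 0 :=
  smul_ne_zero (rescaleProfile_pos hr _).ne' hw

end Radial

/-! ### The radial reparametrisation of a tube inside `S³` -/

namespace Knot.TubularNbhd

variable {K : 𝕊 1 → 𝕊 3} (ν : Knot.TubularNbhd K) (r : ℝ)

open Classical in
/-- The **radial reparametrisation of `S³` along the tube `ν`**: `ν (x, w) ↦ ν (x, ρ_r w)` on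
the image of `ν`, the identity off it. It is continuous (the two descriptions agree off the
compact tube of radius `2`), fixes the knot, maps the knot complement to itself, and carries the
meridian and longitude of `ν` to those of `ν.scale r` (which live at radius `≤ 1`). [folklore] -/
def sphereRescale (p : 𝕊 3) : 𝕊 3 :=
  if p ∈ range ν then ν ((ν.toHomeo.symm p).1, planeRescale r (ν.toHomeo.symm p).2) else p

/-- The radial reparametrisation on the tube. [folklore] -/
theorem sphereRescale_apply_coe (q : (𝕊 1) × 𝔼 2) :
    ν.sphereRescale r (ν q) = ν (q.1, planeRescale r q.2) := by
  rw [sphereRescale, if_pos (mem_range_self q), ν.toHomeo_symm_apply]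

/-- The radial reparametrisation off the tube. [folklore] -/
theorem sphereRescale_of_not_mem {p : 𝕊 3} (hp : p ∉ range ν) : ν.sphereRescale r p = p := by
  rw [sphereRescale, if_neg hp]

/-- Off the compact tube of radius `2` the radial reparametrisation is the identity. [folklore] -/
theorem sphereRescale_of_not_mem_image {p : 𝕊 3}
    (hp : p ∉ ν '' (univ ×ˢ Metric.closedBall (0 : 𝔼 2) 2)) : ν.sphereRescale r p = p := by
  by_cases h : p ∈ range ν
  · obtain ⟨⟨x, w⟩, rfl⟩ := h
    rw [sphereRescale_apply_coe]
    have hw : 2 ≤ ‖w‖ := by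
      by_contra hlt
      exact hp ⟨(x, w), ⟨mem_univ _, by simpa using (not_le.1 hlt).le⟩, rfl⟩
    rw [planeRescale_of_two_le_norm r hw]
  · exact ν.sphereRescale_of_not_mem r h

/-- The radial reparametrisation of `S³` along a tube is continuous. [folklore] -/
theorem continuous_sphereRescale : Continuous (ν.sphereRescale r) := by
  rw [continuous_iff_continuousAt]
  intro p
  by_cases hp : p ∈ range ν
  · -- on the open tube it is `ν ∘ (id × ρ) ∘ ν⁻¹`
    have hopen : IsOpen (range ν) := ν.isOpenEmbedding.isOpen_range
    have hev : ν.sphereRescale r =ᶠ[𝓝 p]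
        fun p ↦ ν ((ν.toHomeo.symm p).1, planeRescale r (ν.toHomeo.symm p).2) :=
      Filter.eventually_of_mem (hopen.mem_nhds hp) fun q hq ↦ by
        rw [sphereRescale, if_pos hq]
    refine ContinuousAt.congr ?_ hev.symm
    have hsymm : ContinuousAt ν.toHomeo.symm p :=
      ν.toHomeo.continuousOn_symm.continuousAt (by
        rw [ν.toHomeo_target]; exact hopen.mem_nhds hp)
    exact ν.continuous.continuousAt.comp
      (hsymm.fst.prodMk ((continuous_planeRescale r).continuousAt.comp hsymm.snd))
  · -- off the compact tube of radius `2` it is the identity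
    set C : Set (𝕊 3) := ν '' (univ ×ˢ Metric.closedBall (0 : 𝔼 2) 2) with hC
    have hCc : IsCompact C := (isCompact_univ.prod (isCompact_closedBall _ _)).image ν.continuous
    have hpC : p ∉ C := fun h ↦ hp (image_subset_range _ _ h)
    have hev : ν.sphereRescale r =ᶠ[𝓝 p] id :=
      Filter.eventually_of_mem (hCc.isClosed.isOpen_compl.mem_nhds hpC) fun q hq ↦
        ν.sphereRescale_of_not_mem_image r hq
    exact continuousAt_id.congr hev.symm

/-- The radial reparametrisation maps the knot complement to itself (`0 < r`). [folklore] -/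
theorem sphereRescale_mem_compl {r : ℝ} (hr : 0 < r) {p : 𝕊 3} (hp : p ∈ (range K)ᶜ) :
    ν.sphereRescale r p ∈ (range K)ᶜ := by
  by_cases h : p ∈ range ν
  · obtain ⟨⟨x, w⟩, rfl⟩ := h
    rw [sphereRescale_apply_coe]
    have hw : w ≠ 0 := by
      rintro rfl
      exact hp ⟨x, (ν.coe_apply_zero x).symm⟩
    exact ν.apply_mem_compl_range (planeRescale_ne_zero hr hw)
  · rwa [ν.sphereRescale_of_not_mem r h]

end Knot.TubularNbhd

/-! ### The framing of the rescaled tubular neighbourhood -/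

namespace Knot.TubularNbhd

attribute [local instance] fact_finrank_euclideanSpace_two fact_finrank_euclideanSpace_four

variable {K : Knot} (ν : Knot.TubularNbhd K) (r : ℝ) (hr : 0 < r)

/-- The radial reparametrisation along `ν`, as a continuous self-map of the knot complement. [folklore] -/
def complRescale : C(K.complement, K.complement) where
  toFun a := ⟨ν.sphereRescale r a, ν.sphereRescale_mem_compl hr a.2⟩
  continuous_toFun := ((ν.continuous_sphereRescale r).comp continuous_subtype_val).subtype_mk _

/-- The complement map on points. [folklore] -/
@[simp] theorem coe_complRescale_apply (a : K.complement) :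
    (ν.complRescale r hr a : 𝕊 3) = ν.sphereRescale r a := rfl

/-- On the closed unit tube, off the zero section, the complement map is the fibre rescaling. [folklore] -/
theorem complRescale_apply_coe {x : 𝕊 1} {w : 𝔼 2} (hw : ‖w‖ ≤ 1) (h : ν (x, w) ∈ (range K)ᶜ)
    (h' : ν (x, r • w) ∈ (range K)ᶜ) :
    ν.complRescale r hr ⟨ν (x, w), h⟩ = ⟨ν (x, r • w), h'⟩ := by
  apply Subtype.ext
  simp only [coe_complRescale_apply]
  rw [ν.sphereRescale_apply_coe, planeRescale_of_norm_le_one r hw]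

/-- The complement map sends the base point of `ν` to that of `ν.scale r`. [folklore] -/
theorem complRescale_basePoint :
    ν.complRescale r hr ν.basePoint = (ν.scale r hr).basePoint := by
  apply Subtype.ext
  simp only [coe_basePoint, scale_apply]
  rw [coe_complRescale_apply, coe_basePoint, ν.sphereRescale_apply_coe, planeRescale_of_norm_le_one]
  rw [framingBaseVector, norm_smul, norm_eq_of_mem_sphere]
  norm_num

/-- The meridian of `ν.scale r` is the image of the meridian of `ν`. [folklore] -/
theorem meridian_scale : (ν.scale r hr).meridian =
    (ν.meridian.map (ν.complRescale r hr).continuous).cast (ν.complRescale_basePoint r hr).symm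
      (ν.complRescale_basePoint r hr).symm := by
  apply Path.ext
  funext s
  apply Subtype.ext
  change (ν.scale r hr) (circlePoint 0, (1 / 2 : ℝ) • (circlePoint (2 * Real.pi * s) : 𝔼 2)) =
    ν.sphereRescale r (ν (circlePoint 0, (1 / 2 : ℝ) • (circlePoint (2 * Real.pi * s) : 𝔼 2)))
  rw [ν.sphereRescale_apply_coe, planeRescale_of_norm_le_one, scale_apply]
  rw [norm_smul, norm_eq_of_mem_sphere]
  norm_num

/-- The longitude of `ν.scale r` is the image of the longitude of `ν`. [folklore] -/
theorem longitude_scale : (ν.scale r hr).longitude =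
    (ν.longitude.map (ν.complRescale r hr).continuous).cast (ν.complRescale_basePoint r hr).symm
      (ν.complRescale_basePoint r hr).symm := by
  apply Path.ext
  funext s
  apply Subtype.ext
  change (ν.scale r hr) (circlePoint (2 * Real.pi * s), framingBaseVector) =
    ν.sphereRescale r (ν (circlePoint (2 * Real.pi * s), framingBaseVector))
  rw [ν.sphereRescale_apply_coe, planeRescale_of_norm_le_one, scale_apply]
  rw [framingBaseVector, norm_smul, norm_eq_of_mem_sphere]
  norm_num

/-- In the fundamental group of the complement, the class of a transported loop is the image of
its class under the homomorphism induced by the complement map. [folklore] -/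
theorem fromPath_mk_cast_map_rescale {b' : K.complement} (γ : Path ν.basePoint ν.basePoint)
    (hb : ν.complRescale r hr ν.basePoint = b') :
    FundamentalGroup.fromPath (Path.Homotopic.Quotient.mk
      ((γ.map (ν.complRescale r hr).continuous).cast hb.symm hb.symm)) =
      FundamentalGroup.mapOfEq (ν.complRescale r hr) hb
        (FundamentalGroup.fromPath (Path.Homotopic.Quotient.mk γ)) := by
  rw [FundamentalGroup.mapOfEq_apply, Path.Homotopic.Quotient.mk_cast, Path.Homotopic.Quotient.mk_map]

/-- **Rescaling the fibres does not change the framing**: if `ν` has framing `m`, so does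
`ν.scale r` (`0 < r`) — the relation `[λ] = m • [μ]` in `π₁(S³ ∖ K, p₀)ᵃᵇ` is carried to the
corresponding relation at the new base point by the homomorphism induced by the radial
reparametrisation of `S³` along `ν`, which maps meridian to meridian and longitude to longitude
(`meridian_scale`, `longitude_scale`). Rolfsen, *Knots and Links* (1976), §9.F (the framing
curve may be taken on a tube of any radius). [cite: Rolfsen1976, §9.F] -/
theorem HasFraming.scale {m : ℤ} (h : ν.HasFraming m) : (ν.scale r hr).HasFraming m := by
  unfold HasFraming at h ⊢
  set G := FundamentalGroup.mapOfEq (ν.complRescale r hr) (ν.complRescale_basePoint r hr)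
    with hG
  have h' := congrArg (Abelianization.map G) h
  simp only [map_zpow, Abelianization.map_of] at h'
  rw [ν.meridian_scale, ν.longitude_scale,
    ν.fromPath_mk_cast_map_rescale r hr _ (ν.complRescale_basePoint r hr),
    ν.fromPath_mk_cast_map_rescale r hr _ (ν.complRescale_basePoint r hr), ← hG, h']

end Knot.TubularNbhd

/-! ### Small tubes lie in any neighbourhood of the knot -/

namespace Knot.TubularNbhd

variable {K : 𝕊 1 → 𝕊 3} (ν : Knot.TubularNbhd K)

/-- **Thin closed tubes lie in any neighbourhood of the knot**: for an open `V ⊇ K(S¹)` there is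
a radius `0 < r ≤ 1` with `ν (S¹ × D̄²_r) ⊆ V` (compactness of `S¹`, tube lemma). [folklore] -/
theorem exists_image_closedBall_subset {V : Set (𝕊 3)} (hV : IsOpen V) (hKV : range K ⊆ V) :
    ∃ r : ℝ, 0 < r ∧ r ≤ 1 ∧ ν '' (univ ×ˢ Metric.closedBall (0 : 𝔼 2) r) ⊆ V := by
  have hn : IsOpen (ν ⁻¹' V) := hV.preimage ν.continuous
  have hsub : (univ : Set (𝕊 1)) ×ˢ ({0} : Set (𝔼 2)) ⊆ ν ⁻¹' V := by
    rintro ⟨x, w⟩ ⟨-, hw⟩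
    rw [mem_singleton_iff] at hw
    subst hw
    exact hKV ⟨x, (ν.coe_apply_zero x).symm⟩
  obtain ⟨u, v, -, hv, hu, h0v, huv⟩ :=
    generalized_tube_lemma isCompact_univ isCompact_singleton hn hsub
  obtain ⟨ε, hε, hεv⟩ := Metric.isOpen_iff.1 hv 0 (h0v rfl)
  refine ⟨min (ε / 2) 1, lt_min (half_pos hε) one_pos, min_le_right _ _, ?_⟩
  rintro _ ⟨⟨x, w⟩, ⟨-, hw⟩, rfl⟩
  refine huv ⟨hu (mem_univ x), hεv ?_⟩
  rw [Metric.mem_closedBall, dist_zero_right] at hw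
  rw [Metric.mem_ball, dist_zero_right]
  exact lt_of_le_of_lt (hw.trans (min_le_left _ _)) (half_lt_self hε)

end Knot.TubularNbhd

/-! ### Rescaling the open solid torus -/

section SolidTorus

/-- A point `(r • p, v)` with `‖p‖ < 1`, `0 < r ≤ 1` lies in the open solid torus. [folklore] -/
theorem smul_mem_solidTorus {r : ℝ} (hr : 0 < r) (hr1 : r ≤ 1) {p : 𝔼 2} (hp : ‖p‖ < 1) (v : 𝕊 1) :
    ((r • p, v) : (𝔼 2) × (𝕊 1)) ∈ solidTorus := by
  rw [mem_solidTorus_iff, norm_smul, Real.norm_of_nonneg hr.le]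
  nlinarith

/-- A point `(r⁻¹ • p, v)` with `‖p‖ < r` lies in the open solid torus. [folklore] -/
theorem inv_smul_mem_solidTorus {r : ℝ} (hr : 0 < r) {p : 𝔼 2} (hp : ‖p‖ < r) (v : 𝕊 1) :
    ((r⁻¹ • p, v) : (𝔼 2) × (𝕊 1)) ∈ solidTorus := by
  rw [mem_solidTorus_iff, norm_smul, norm_inv, Real.norm_of_nonneg hr.le, inv_mul_lt_iff₀ hr]
  simpa using hp

open Classical in
/-- **Rescaling the meridian discs of the open solid torus**: the open embedding
`(p, v) ↦ (r • p, v)` of `D̊² × S¹` onto the thinner open solid torus `{‖p‖ < r}` (`0 < r ≤ 1`),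
as an open partial homeomorphism with source `univ`. [folklore] -/
def solidTorusScale (r : ℝ) (hr : 0 < r) (hr1 : r ≤ 1) :
    OpenPartialHomeomorph solidTorus solidTorus where
  toFun b := ⟨(r • (b : (𝔼 2) × (𝕊 1)).1, (b : (𝔼 2) × (𝕊 1)).2),
    smul_mem_solidTorus hr hr1 ((mem_solidTorus_iff _).1 b.2) _⟩
  invFun b := if h : ‖(b : (𝔼 2) × (𝕊 1)).1‖ < r then
      ⟨(r⁻¹ • (b : (𝔼 2) × (𝕊 1)).1, (b : (𝔼 2) × (𝕊 1)).2), inv_smul_mem_solidTorus hr h _⟩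
    else b
  source := univ
  target := {b | ‖(b : (𝔼 2) × (𝕊 1)).1‖ < r}
  map_source' b _ := by
    change ‖r • (b : (𝔼 2) × (𝕊 1)).1‖ < r
    rw [norm_smul, Real.norm_of_nonneg hr.le]
    have hb := (mem_solidTorus_iff _).1 b.2
    nlinarith
  map_target' _ _ := mem_univ _
  left_inv' b _ := by
    have h : ‖r • (b : (𝔼 2) × (𝕊 1)).1‖ < r := by
      rw [norm_smul, Real.norm_of_nonneg hr.le]
      have hb := (mem_solidTorus_iff _).1 b.2
      nlinarith
    apply Subtype.ext
    simp only [dif_pos h, inv_smul_smul₀ hr.ne']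
  right_inv' b hb := by
    apply Subtype.ext
    simp only [dif_pos (show ‖(b : (𝔼 2) × (𝕊 1)).1‖ < r from hb), smul_inv_smul₀ hr.ne']
  open_source := isOpen_univ
  open_target :=
    isOpen_lt ((continuous_fst.comp continuous_subtype_val).norm) continuous_const
  continuousOn_toFun := by
    refine Continuous.continuousOn (Continuous.subtype_mk ?_ _)
    exact ((continuous_fst.comp continuous_subtype_val).const_smul r).prodMk
      (continuous_snd.comp continuous_subtype_val)
  continuousOn_invFun := by
    rw [Topology.IsInducing.subtypeVal.continuousOn_iff]
    have hg : Continuous fun b : solidTorus ↦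
        ((r⁻¹ • (b : (𝔼 2) × (𝕊 1)).1, (b : (𝔼 2) × (𝕊 1)).2) : (𝔼 2) × (𝕊 1)) :=
      ((continuous_fst.comp continuous_subtype_val).const_smul r⁻¹).prodMk
        (continuous_snd.comp continuous_subtype_val)
    refine hg.continuousOn.congr fun b hb ↦ ?_
    have hb' : ‖(b : (𝔼 2) × (𝕊 1)).1‖ < r := hb
    simp only [comp_apply, dif_pos hb']

variable (r : ℝ) (hr : 0 < r) (hr1 : r ≤ 1)

/-- The solid torus rescaling on points. [folklore] -/
@[simp] theorem coe_solidTorusScale_apply (b : solidTorus) :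
    ((solidTorusScale r hr hr1 b : solidTorus) : (𝔼 2) × (𝕊 1)) =
      (r • (b : (𝔼 2) × (𝕊 1)).1, (b : (𝔼 2) × (𝕊 1)).2) := rfl

/-- The solid torus rescaling is defined everywhere. [folklore] -/
@[simp] theorem solidTorusScale_source : (solidTorusScale r hr hr1).source = univ := rfl

/-- The target of the solid torus rescaling is the thinner solid torus `{‖p‖ < r}`. [folklore] -/
theorem solidTorusScale_target :
    (solidTorusScale r hr hr1).target = {b : solidTorus | ‖(b : (𝔼 2) × (𝕊 1)).1‖ < r} := rfl

/-- The inverse of the solid torus rescaling on its target. [folklore] -/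
theorem coe_solidTorusScale_symm_apply {b : solidTorus} (hb : ‖(b : (𝔼 2) × (𝕊 1)).1‖ < r) :
    (((solidTorusScale r hr hr1).symm b : solidTorus) : (𝔼 2) × (𝕊 1)) =
      (r⁻¹ • (b : (𝔼 2) × (𝕊 1)).1, (b : (𝔼 2) × (𝕊 1)).2) := by
  change ((dite (‖(b : (𝔼 2) × (𝕊 1)).1‖ < r) _ _ : solidTorus) : (𝔼 2) × (𝕊 1)) = _
  rw [dif_pos hb]

/-- The solid torus rescaling is `C^∞`. [folklore] -/
theorem contMDiff_solidTorusScale :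
    ContMDiff (𝓘(ℝ, 𝔼 2).prod (𝓡 1)) (𝓘(ℝ, 𝔼 2).prod (𝓡 1)) ∞ (solidTorusScale r hr hr1) := by
  rw [← ContMDiff.subtypeVal_comp_iff]
  have h1 : ContMDiff (𝓘(ℝ, 𝔼 2).prod (𝓡 1)) 𝓘(ℝ, 𝔼 2) ∞
      fun b : solidTorus ↦ r • (b : (𝔼 2) × (𝕊 1)).1 :=
    ((contDiff_const_smul r).contMDiff).comp (contMDiff_fst.comp contMDiff_subtype_val)
  exact h1.prodMk (contMDiff_snd.comp contMDiff_subtype_val)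

/-- The inverse of the solid torus rescaling is `C^∞` on its target. [folklore] -/
theorem contMDiffOn_solidTorusScale_symm :
    ContMDiffOn (𝓘(ℝ, 𝔼 2).prod (𝓡 1)) (𝓘(ℝ, 𝔼 2).prod (𝓡 1)) ∞ (solidTorusScale r hr hr1).symm
      (solidTorusScale r hr hr1).target := by
  have hg : ContMDiff (𝓘(ℝ, 𝔼 2).prod (𝓡 1)) (𝓘(ℝ, 𝔼 2).prod (𝓡 1)) ∞
      fun b : solidTorus ↦
        ((r⁻¹ • (b : (𝔼 2) × (𝕊 1)).1, (b : (𝔼 2) × (𝕊 1)).2) : (𝔼 2) × (𝕊 1)) :=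
    (((contDiff_const_smul r⁻¹).contMDiff).comp (contMDiff_fst.comp contMDiff_subtype_val)).prodMk
      (contMDiff_snd.comp contMDiff_subtype_val)
  intro b hb
  rw [← ContMDiffWithinAt.subtypeVal_comp_iff]
  refine (hg b).contMDiffWithinAt.congr (fun b' hb' ↦ ?_) ?_
  · exact coe_solidTorusScale_symm_apply r hr hr1 hb'
  · exact coe_solidTorusScale_symm_apply r hr hr1 hb

/-- The image of a map precomposed with the solid torus rescaling is the image of the thin solid
torus. [folklore] -/
theorem range_comp_solidTorusScale {Y : Type*} (f : solidTorus → Y) :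
    range (f ∘ solidTorusScale r hr hr1) = f '' {b : solidTorus | ‖(b : (𝔼 2) × (𝕊 1)).1‖ < r} :=
  (solidTorusScale r hr hr1).range_comp_eq_image_target rfl f

end SolidTorus

/-! ### Rescaling a surgery presentation -/

section Presentation

universe u v w u'

/-- **The surgery relation of the rescaled tubular neighbourhood** is that of `ν` at the rescaled
point of the solid torus: `(ν.scale r).glueRel a (p, v) ↔ ν.glueRel a (r • p, v)` for `‖p‖ < 1`
(`0 < r ≤ 1`; the radius `t` on the one side corresponds to the radius `r t` on the other).
[folklore] -/
theorem Knot.TubularNbhd.glueRel_scale_iff {K : 𝕊 1 → 𝕊 3} (ν : Knot.TubularNbhd K) {r : ℝ}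
    (hr : 0 < r) (hr1 : r ≤ 1) (a : 𝕊 3) {b : (𝔼 2) × (𝕊 1)} (hb : ‖b.1‖ < 1) :
    (ν.scale r hr).glueRel a b ↔ ν.glueRel a (r • b.1, b.2) := by
  constructor
  · rintro ⟨u, t, ht, hb1, ha⟩
    refine ⟨u, r * t, ⟨mul_pos hr ht.1, ?_⟩, ?_, ?_⟩
    · nlinarith [ht.2]
    · change r • b.1 = (r * t) • (u : 𝔼 2)
      rw [hb1, smul_smul]
    · rw [ha, scale_apply, smul_smul]
  · rintro ⟨u, t, ht, hb1, ha⟩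
    change r • b.1 = t • (u : 𝔼 2) at hb1
    have htr : t = r * ‖b.1‖ := by
      have := congrArg (fun p : 𝔼 2 ↦ ‖p‖) hb1
      simp only [norm_smul, norm_eq_of_mem_sphere u, mul_one, Real.norm_of_nonneg hr.le,
        Real.norm_of_nonneg ht.1.le] at this
      exact this.symm
    have ht' : t < r := by rw [htr]; nlinarith
    refine ⟨u, t / r, ⟨div_pos ht.1 hr, (div_lt_one hr).2 ht'⟩, ?_, ?_⟩
    · have := congrArg (fun p : 𝔼 2 ↦ r⁻¹ • p) hb1
      simp only [inv_smul_smul₀ hr.ne', smul_smul] at this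
      rw [this, div_eq_inv_mul]
    · rw [ha, scale_apply, smul_smul, mul_div_cancel₀ _ hr.ne']

variable {EY : Type u} {HY : Type v} [NormedAddCommGroup EY] [NormedSpace ℝ EY]
  [TopologicalSpace HY] {IY : ModelWithCorners ℝ EY HY} {Y : Type w} [TopologicalSpace Y]
  [ChartedSpace HY Y] {ι : Type u'} [Finite ι]

/-- **Rescaling a surgery presentation.** If `Y` is presented as surgery on the link `L` with
pairwise disjoint tubular neighbourhoods `νᵢ` (`Link.IsSurgeryPresentation IY Y L ν`: open
embeddings `jA` of the link complement and `jBᵢ` of the solid tori, glued along `surgeryRel νᵢ`),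
then for radii `0 < rᵢ ≤ 1` it is also presented with the rescaled neighbourhoods
`νᵢ.scale rᵢ`: keep `jA`, replace `jBᵢ` by `jBᵢ ∘ (p, v) ↦ (rᵢ p, v)` (a smooth open embedding,
`solidTorusScale`); the annulus `jBᵢ {rᵢ ≤ ‖p‖ < 1}` is covered by the link complement
(`jBᵢ (t u, v) = jA (νᵢ (u, t v))`, and `νᵢ (u, t v)` misses every component by the disjointness
of the tubes), and the surgery relations correspond (`Knot.TubularNbhd.glueRel_scale_iff`). The
surgery only depends on the germ of the tubular neighbourhoods along the link: Rolfsen, *Knots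
and Links* (1976), §9.F; Kosinski, *Differential Manifolds* (1993), III.(3.4).
[cite: Rolfsen1976, §9.F] -/
theorem Link.IsSurgeryPresentation.scale {L : Link ι}
    {ν : ∀ i, Knot.TubularNbhd (L.component i)}
    (hdisj : Pairwise fun i j ↦ Disjoint (range (ν i)) (range (ν j)))
    (h : L.IsSurgeryPresentation IY Y ν) (r : ι → ℝ) (hr : ∀ i, 0 < r i) (hr1 : ∀ i, r i ≤ 1) :
    L.IsSurgeryPresentation IY Y fun i ↦ (ν i).scale (r i) (hr i) := by
  obtain ⟨jA, jB, hA, hAo, hB, hcov, hBdisj, hglue⟩ := h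
  set Φ : ι → OpenPartialHomeomorph solidTorus solidTorus :=
    fun i ↦ solidTorusScale (r i) (hr i) (hr1 i) with hΦ
  refine ⟨jA, fun i ↦ jB i ∘ Φ i, hA, hAo, fun i ↦ ⟨?_, ?_⟩, ?_, ?_, fun i a b ↦ ?_⟩
  · exact (hB i).1.comp_openPartialHomeomorph (Φ i) rfl
      (contMDiff_solidTorusScale _ _ _).contMDiffOn (contMDiffOn_solidTorusScale_symm _ _ _)
  · rw [hΦ, range_comp_solidTorusScale]
    exact (Topology.IsOpenEmbedding.mk (hB i).1.isEmbedding (hB i).2).isOpenMap _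
      (solidTorusScale (r i) (hr i) (hr1 i)).open_target
  · -- the pieces still cover `Y`
    refine eq_univ_of_forall fun y ↦ ?_
    rcases eq_univ_iff_forall.1 hcov y with hy | hy
    · exact Or.inl hy
    · obtain ⟨i, hy⟩ := mem_iUnion.1 hy
      obtain ⟨b, rfl⟩ := hy
      by_cases hbr : ‖(b : (𝔼 2) × (𝕊 1)).1‖ < r i
      · refine Or.inr (mem_iUnion.2 ⟨i, (Φ i).symm b, ?_⟩)
        change jB i (Φ i ((Φ i).symm b)) = jB i b
        rw [(Φ i).right_inv (show b ∈ (Φ i).target from hbr)]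
      · refine Or.inl ?_
        set p : 𝔼 2 := (b : (𝔼 2) × (𝕊 1)).1 with hp
        set v : 𝕊 1 := (b : (𝔼 2) × (𝕊 1)).2 with hv
        have hp1 : ‖p‖ < 1 := (mem_solidTorus_iff _).1 b.2
        have hp0 : 0 < ‖p‖ := (hr i).trans_le (not_lt.1 hbr)
        set t : ℝ := ‖p‖ with ht
        have hu1 : t⁻¹ • p ∈ Metric.sphere (0 : 𝔼 2) 1 := by
          rw [mem_sphere_zero_iff_norm, norm_smul, norm_inv, Real.norm_of_nonneg hp0.le, ← ht,
            inv_mul_cancel₀ hp0.ne']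
        set u : 𝕊 1 := ⟨t⁻¹ • p, hu1⟩ with hu
        have hpu : p = t • (u : 𝔼 2) := by
          change p = t • (t⁻¹ • p)
          rw [smul_inv_smul₀ hp0.ne']
        have ha₀ : ν i (u, t • (v : 𝔼 2)) ∈ L.complement := by
          rw [Link.mem_complement_iff]
          intro j hmem
          by_cases hji : j = i
          · subst hji
            exact (ν j).apply_mem_compl_range
              (smul_ne_zero hp0.ne' (ne_zero_of_mem_unit_sphere v)) hmem
          · exact Set.disjoint_left.1 (hdisj hji) ((ν j).range_subset_range hmem)
              (mem_range_self _)
        refine ⟨⟨ν i (u, t • (v : 𝔼 2)), ha₀⟩, ?_⟩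
        rw [hglue i]
        exact ⟨u, t, ⟨hp0, hp1⟩, hpu, rfl⟩
  · intro i j hij
    refine Disjoint.mono ?_ ?_ (hBdisj hij) <;> rw [range_comp] <;> exact image_subset_range _ _
  · change jA a = jB i (Φ i b) ↔ _
    rw [hglue i a (Φ i b)]
    change (ν i).glueRel (a : 𝕊 3) ((Φ i b : solidTorus) : (𝔼 2) × (𝕊 1)) ↔
      ((ν i).scale (r i) (hr i)).glueRel (a : 𝕊 3) (b : (𝔼 2) × (𝕊 1))
    rw [hΦ, coe_solidTorusScale_apply,
      (ν i).glueRel_scale_iff (hr i) (hr1 i) _ ((mem_solidTorus_iff _).1 b.2)]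

/-- **Leaf (A) discharged: shrinking the tubes of a surgery presentation**
(`Link.IsSurgeryPresentation.shrink`, `KirbyMovesBlowDown.lean`). Given a presentation of `Y` as
surgery on `L` with tubular neighbourhoods `νᵢ` of framings `mᵢ` and open neighbourhoods
`Vᵢ ⊇ Kᵢ(S¹)`: choose radii `0 < rᵢ ≤ 1` with `νᵢ (S¹ × D̄²_{rᵢ}) ⊆ Vᵢ` (compactness,
`Knot.TubularNbhd.exists_image_closedBall_subset`) and rescale, `ν'ᵢ = νᵢ.scale rᵢ`: same
images (`range_scale`), same framings (`HasFraming.scale`), closed unit tubes inside `Vᵢ`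
(`image_scale_closedBall`), and `Y` is presented with `ν'` (`Link.IsSurgeryPresentation.scale`).
Rolfsen, *Knots and Links* (1976), §9.F; Kosinski, *Differential Manifolds* (1993), III.(3.4).
[cite: Rolfsen1976, §9.F] -/
theorem Link.IsSurgeryPresentation.shrink_holds : Link.IsSurgeryPresentation.shrink.{u, v, w, u'} := by
  intro EY HY _ _ _ IY Y _ _ ι _ L m ν hν hdisj h V hV hKV
  choose r hr hr1 hrV using fun i ↦ (ν i).exists_image_closedBall_subset (hV i) (hKV i)
  refine ⟨fun i ↦ (ν i).scale (r i) (hr i), fun i ↦ Knot.TubularNbhd.HasFraming.scale (ν i) (r i) (hr i) (hν i),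
    fun i ↦ (ν i).range_scale _ _, fun i ↦ ?_, h.scale hdisj r hr hr1⟩
  rw [(ν i).image_scale_closedBall]
  exact hrV i

end Presentation

end Literature.Topology.FourManifolds
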